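import Literature.Computability.QuantumComplexity.Lemma24Amplitude
import Literature.Computability.QuantumComplexity.Lemma24Realify
import HarnessLib

/-!
# Aaronson–Ambainis Lemma 24 over the sign basis, VII: transcribing Clifford+`T` gates

Seventh file of the discharge of `AaronsonAmbainis2018_lemma24_sign_hard` (plan in
`Lemma24Catalysis.lean`). A Clifford+`T` gate list `gs` on a working register of `K` wires is read in
three ways on the complex register `QReg (K + 2)` (working wires first, then the catalyst `cat` and
the helper `hlp`, `Fin.natAdd K 0/1`) and transcribed to the sign basis on the real register
`QReg (K + 2 + 1)` (the real/imaginary wire `ρ = Fin.last (K + 2)` last, `Lemma24Realify.lean`):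

* `tOp g` — the gate itself (lifted), `ztOp g` — the same with `T` replaced by `ZT`, and `injOp g` —
  the same with `T` replaced by the injection word `CS · CNOT` through the catalyst
  (`Lemma24Catalysis.lean`);
* `realGates g` — the sign-basis word: `H ↦ H`, `CNOT ↦ H CZ H`, `S ↦ CZ H CZ H` with `ρ`
  (`reOp S = CNOT·CZ`), `T ↦ H CZ H` through `cat` then `CCZ H CCZ H` with `ρ` (`reOp CS = CCX·CCZ`,
  `reOp_csGate`, an `8 × 8` computation);
* **`toMatrix_realGates : ⟦realGates g⟧ = reOp (injOp g)`**, **`injOp_mul_projA :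
  injOp g · Π_A = Π_A · tOp g`**, `injOp_mul_projAperp : injOp g · Π_⊥ = Π_⊥ · ztOp g`, and their
  list forms `toMatrix_transcribe`, `injProd_mul_projA`, `injProd_mul_projAperp`, together with
  `tProd_eq : ∏ tOp = (⟦gs⟧ lifted)`, `ztProd` unitary, wires of the transcription
  (`mem_wires_transcribe`).

## References

* S. Aaronson, A. Ambainis, *Forrelation*, SIAM J. Comput. 47 (2018), §6, Lemma 24 (p. 26).
* M. A. Nielsen, I. L. Chuang, *Quantum Computation and Quantum Information*, CUP 2010, §4.2, §4.3
  (`CNOT = (1 ⊗ H) CZ (1 ⊗ H)`, Toffoli `= (1 ⊗ 1 ⊗ H) CCZ (1 ⊗ 1 ⊗ H)`), §10.6.2.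
* E. Bernstein, U. Vazirani, *Quantum complexity theory*, SIAM J. Comput. 26 (1997), §8.
-/

noncomputable section

namespace Literature.Computability.QuantumComplexity

open Matrix _root_.Computability Complexity Cryptography Finset

namespace Lemma24

/-! ### Small identities: `CNOT = H₂ CZ H₂`, realness of `CNOT` -/

/-- `CNOT = (1 ⊗ H) · CZ · (1 ⊗ H)` on two wires. [cite: NielsenChuang2010, §4.3] -/
theorem cnot_eq_hadamard_cz_hadamard :
    cnot = placeGate (wireEmb (1 : Fin 2)) hGate * cz * placeGate (wireEmb (1 : Fin 2)) hGate := by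
  apply (Matrix.reindexRingEquiv ℂ qRegTwoEquiv).injective
  have hcn : Matrix.reindex qRegTwoEquiv qRegTwoEquiv cnot = cnotm := by
    ext i j; fin_cases i <;> fin_cases j <;> simp [qRegTwoEquiv, cnot, cnotm]
  simp only [map_mul, Matrix.coe_reindexRingEquiv, reindex_onSecond_hGate, reindex_cz, hcn, Matrix.smul_mul,
    Matrix.mul_smul, smul_smul, hm_csignTwo_hm]
  have e : invSqrt2 * (invSqrt2 * 2) = 1 := by rw [← mul_assoc]; exact invSqrt2_sq_mul_two
  rw [e, one_smul]

/-- `CNOT` is a real matrix. [folklore] -/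
theorem isRealMatrix_cnot : IsRealMatrix cnot := by
  intro x y; simp only [cnot, Matrix.of_apply]; split_ifs <;> simp

/-- `X = H Z H` is a real matrix. [folklore] -/
theorem isRealMatrix_pauliX : IsRealMatrix pauliX := by
  intro x y; simp only [pauliX, Matrix.of_apply]; split_ifs <;> simp

/-! ### The `8 × 8` computation: `reOp CS = (1⊗1⊗H) CCZ (1⊗1⊗H) CCZ` (basis order `|q a ρ⟩`) -/

/-- The basis bijection `QReg 3 ≃ Fin 8`, `|x₀ x₁ x₂⟩ ↦ 4x₀ + 2x₁ + x₂`. [folklore] -/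
def qRegThreeEquiv : QReg 3 ≃ Fin 8 where
  toFun x := ⟨4 * (x 0).toNat + 2 * (x 1).toNat + (x 2).toNat, by cases x 0 <;> cases x 1 <;> cases x 2 <;> decide⟩
  invFun i := ![decide (4 ≤ (i : ℕ)), decide ((i : ℕ) % 4 ≥ 2), decide ((i : ℕ) % 2 = 1)]
  left_inv := by decide
  right_inv := by decide

/-- `H` on the third of three wires, integer pattern (times `√2`). [cite: NielsenChuang2010, §4.2] -/
def hm8 : Matrix (Fin 8) (Fin 8) ℂ :=
  !![1, 1, 0, 0, 0, 0, 0, 0; 1, -1, 0, 0, 0, 0, 0, 0; 0, 0, 1, 1, 0, 0, 0, 0; 0, 0, 1, -1, 0, 0, 0, 0;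
     0, 0, 0, 0, 1, 1, 0, 0; 0, 0, 0, 0, 1, -1, 0, 0; 0, 0, 0, 0, 0, 0, 1, 1; 0, 0, 0, 0, 0, 0, 1, -1]

/-- `CCZ`, explicitly: `diag(1,…,1,−1)`. [cite: NielsenChuang2010, §4.3] -/
def cczm : Matrix (Fin 8) (Fin 8) ℂ :=
  Matrix.diagonal ![1, 1, 1, 1, 1, 1, 1, -1]

/-- The realified controlled-`S`, explicitly: identity except the quarter turn `[[0,−1],[1,0]]` on the
last two coordinates `|110⟩, |111⟩`. [cite: BernsteinVazirani1997, §8] -/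
def jm8 : Matrix (Fin 8) (Fin 8) ℂ :=
  !![1, 0, 0, 0, 0, 0, 0, 0; 0, 1, 0, 0, 0, 0, 0, 0; 0, 0, 1, 0, 0, 0, 0, 0; 0, 0, 0, 1, 0, 0, 0, 0;
     0, 0, 0, 0, 1, 0, 0, 0; 0, 0, 0, 0, 0, 1, 0, 0; 0, 0, 0, 0, 0, 0, 0, -1; 0, 0, 0, 0, 0, 0, 1, 0]

/-- `hm8 · CCZ`, explicitly. [folklore] -/
def hcm8 : Matrix (Fin 8) (Fin 8) ℂ :=
  !![1, 1, 0, 0, 0, 0, 0, 0; 1, -1, 0, 0, 0, 0, 0, 0; 0, 0, 1, 1, 0, 0, 0, 0; 0, 0, 1, -1, 0, 0, 0, 0;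
     0, 0, 0, 0, 1, 1, 0, 0; 0, 0, 0, 0, 1, -1, 0, 0; 0, 0, 0, 0, 0, 0, 1, -1; 0, 0, 0, 0, 0, 0, 1, 1]

/-- `X` on the third wire controlled by the first two (Toffoli), explicitly. [cite: NielsenChuang2010, §4.3] -/
def toffm8 : Matrix (Fin 8) (Fin 8) ℂ :=
  !![1, 0, 0, 0, 0, 0, 0, 0; 0, 1, 0, 0, 0, 0, 0, 0; 0, 0, 1, 0, 0, 0, 0, 0; 0, 0, 0, 1, 0, 0, 0, 0;
     0, 0, 0, 0, 1, 0, 0, 0; 0, 0, 0, 0, 0, 1, 0, 0; 0, 0, 0, 0, 0, 0, 0, 1; 0, 0, 0, 0, 0, 0, 1, 0]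

/-- `hm8 · cczm = hcm8`. [folklore] -/
theorem hm8_mul_cczm : hm8 * cczm = hcm8 := by
  ext i j
  fin_cases i <;> fin_cases j <;> simp [hm8, cczm, hcm8, Matrix.mul_apply, Matrix.diagonal_apply]

/-- `hm8 · cczm · hm8 = 2 · Toffoli` (`(1⊗1⊗H) CCZ (1⊗1⊗H)` is the Toffoli gate). [cite: NielsenChuang2010, §4.3] -/
theorem hm8_cczm_hm8 : hm8 * cczm * hm8 = (2 : ℂ) • toffm8 := by
  rw [hm8_mul_cczm]
  ext i j
  fin_cases i <;> fin_cases j <;> simp [hm8, hcm8, toffm8, Matrix.mul_apply, Fin.sum_univ_eight] <;> norm_num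

/-- `Toffoli · CCZ = jm8` (the realified controlled-`S`). [cite: BernsteinVazirani1997, §8] -/
theorem toffm8_mul_cczm : toffm8 * cczm = jm8 := by
  ext i j
  fin_cases i <;> fin_cases j <;> simp [toffm8, cczm, jm8, Matrix.mul_apply, Matrix.diagonal_apply]

/-- `H` on the third of three wires is `(1/√2) hm8`. [cite: NielsenChuang2010, §4.2] -/
theorem reindex_hadamard_third :
    Matrix.reindex qRegThreeEquiv qRegThreeEquiv (placeGate (wireEmb (2 : Fin 3)) hGate) = invSqrt2 • hm8 := by
  have hcomp : ∀ x : QReg 3, x ∘ wireEmb (2 : Fin 3) = fun _ => x 2 := fun x => funext fun _ => by simp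
  ext i j
  fin_cases i <;> fin_cases j <;>
    simp [qRegThreeEquiv, placeGate_apply, range_wireEmb, Fin.forall_fin_succ, hcomp, hGate, invSqrt2, hm8]

/-- `CCZ` is `cczm`. [cite: NielsenChuang2010, §4.3] -/
theorem reindex_ccsign : Matrix.reindex qRegThreeEquiv qRegThreeEquiv ccsign = cczm := by
  ext i j
  fin_cases i <;> fin_cases j <;> simp [qRegThreeEquiv, ccsign, cczm, funext_iff, Fin.forall_fin_succ]

/-- `Fin.init` of a three-bit label. [folklore] -/
theorem init_vec3 (a b c : Bool) : Fin.init (![a, b, c] : QReg 3) = ![a, b] := by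
  funext i; fin_cases i <;> rfl

/-- The realified controlled-`S` is `jm8`. [cite: BernsteinVazirani1997, §8] -/
theorem reindex_reOp_csGate : Matrix.reindex qRegThreeEquiv qRegThreeEquiv (reOp csGate) = jm8 := by
  ext i j
  fin_cases i <;> fin_cases j <;>
    simp [qRegThreeEquiv, reOp, init_vec3, csGate, funext_iff, Fin.forall_fin_two, blockEntry, jm8,
      show (Fin.last 2 : Fin 3) = 2 from rfl]

/-- **Realification of the controlled-`S` gate**: `reOp CS = H_ρ · CCZ · H_ρ · CCZ` on the three wires
`(q, a, ρ)` — first `CCZ`, then the Toffoli `H_ρ CCZ H_ρ` with target `ρ`. [cite: BernsteinVazirani1997, §8] -/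
theorem reOp_csGate :
    reOp csGate = placeGate (wireEmb (2 : Fin 3)) hGate * ccsign * placeGate (wireEmb (2 : Fin 3)) hGate * ccsign := by
  apply (Matrix.reindexRingEquiv ℂ qRegThreeEquiv).injective
  simp only [map_mul, Matrix.coe_reindexRingEquiv, reindex_hadamard_third, reindex_ccsign, reindex_reOp_csGate,
    Matrix.smul_mul, Matrix.mul_smul, smul_smul, hm8_cczm_hm8]
  have e : invSqrt2 * (invSqrt2 * 2) = 1 := by rw [← mul_assoc]; exact invSqrt2_sq_mul_two
  rw [e, one_smul, toffm8_mul_cczm]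


/-! ### The registers: working wires, catalyst, helper, `ρ` -/

variable {K : ℕ}

/-- A working wire in the complex register `QReg (K + 2)`. [folklore] -/
abbrev wk (i : Fin K) : Fin (K + 2) := Fin.castAdd 2 i

/-- The catalyst wire of the complex register. [folklore] -/
abbrev catC (K : ℕ) : Fin (K + 2) := Fin.natAdd K 0

/-- The helper wire of the complex register. [folklore] -/
abbrev hlpC (K : ℕ) : Fin (K + 2) := Fin.natAdd K 1

/-- The real/imaginary wire of the real register `QReg (K + 2 + 1)` (last). [folklore] -/
abbrev rho (K : ℕ) : Fin (K + 2 + 1) := Fin.last (K + 2)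

/-- The real index of a complex wire. [folklore] -/
abbrev rl (j : Fin (K + 2)) : Fin (K + 2 + 1) := Fin.castSucc j

/-- A working wire is not the catalyst. [folklore] -/
theorem wk_ne_catC (i : Fin K) : wk i ≠ catC K := by
  intro h; have := congrArg Fin.val h; have := i.isLt; simp at *; omega

/-- A real index of a complex wire is not `ρ`. [folklore] -/
theorem rl_ne_rho (j : Fin (K + 2)) : rl j ≠ rho K := (Fin.castSucc_lt_last j).ne

/-- `rl` is injective. [folklore] -/
theorem rl_injective : Function.Injective (rl (K := K)) := Fin.castSucc_injective _

/-- The catalyst is off the working register. [folklore] -/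
theorem catC_not_mem_range_castAddEmb (K : ℕ) : catC K ∉ Set.range (Fin.castAddEmb 2 : Fin K ↪ Fin (K + 2)) := by
  rintro ⟨i, hi⟩
  exact wk_ne_catC i hi

/-! ### Embedding bookkeeping -/

/-- The embedding `![i, j, l]` of three pairwise distinct wires. [folklore] -/
def tripleEmb {N : ℕ} (i j l : Fin N) (hij : i ≠ j) (hil : i ≠ l) (hjl : j ≠ l) : Fin 3 ↪ Fin N :=
  ⟨![i, j, l], by
    intro a b hab
    fin_cases a <;> fin_cases b <;> simp_all [hij.symm, hil.symm, hjl.symm]⟩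

/-- `CCZ` of the sign basis on three pairwise distinct wires. [cite: AaronsonAmbainis2018, §6 (p. 26)] -/
def sCCZ {N : ℕ} (i j l : Fin N) (hij : i ≠ j) (hil : i ≠ l) (hjl : j ≠ l) : QGate hSign N :=
  QGate.gate HSignOp.CCZ (tripleEmb i j l hij hil hjl)

/-- A one-wire embedding into the working register, lifted to the real register. [folklore] -/
theorem trans_trans_fin_one (e : Fin 1 ↪ Fin K) :
    (e.trans (Fin.castAddEmb 2)).trans Fin.castSuccEmb = wireEmb (rl (wk (e 0))) := by
  ext j; rw [Subsingleton.elim j 0]; rfl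

/-- A one-wire embedding into the working register, in the complex register. [folklore] -/
theorem trans_fin_one (e : Fin 1 ↪ Fin K) : e.trans (Fin.castAddEmb 2) = wireEmb (wk (e 0)) := by
  ext j; rw [Subsingleton.elim j 0]; rfl

/-- A two-wire embedding into the working register, lifted to the real register. [folklore] -/
theorem trans_trans_fin_two (e : Fin 2 ↪ Fin K) :
    (e.trans (Fin.castAddEmb 2)).trans Fin.castSuccEmb =
      pairEmb (rl (wk (e 0))) (rl (wk (e 1))) (fun h => by
        have := e.injective (Fin.castAdd_injective _ _ (rl_injective h)); simp at this) := by
  ext j; fin_cases j <;> rfl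

/-- The lift of a one-wire embedding keeps `ρ` last: `liftEmb E = (E 0, ρ)`. [folklore] -/
theorem liftEmb_fin_one (E : Fin 1 ↪ Fin (K + 2)) : liftEmb E = pairEmb (rl (E 0)) (rho K) (rl_ne_rho _) := by
  ext j
  fin_cases j
  · exact congrArg Fin.val (liftEmb_castSucc E 0)
  · exact congrArg Fin.val (liftEmb_last E)

/-- The lift of the pair `(q, cat)` is the triple `(q, cat, ρ)`. [folklore] -/
theorem liftEmb_pairEmb (q a : Fin (K + 2)) (h : q ≠ a) :
    liftEmb (pairEmb q a h) = tripleEmb (rl q) (rl a) (rho K) (fun h' => h (rl_injective h')) (rl_ne_rho _) (rl_ne_rho _) := by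
  ext j
  fin_cases j
  · exact congrArg Fin.val (liftEmb_castSucc (pairEmb q a h) 0)
  · exact congrArg Fin.val (liftEmb_castSucc (pairEmb q a h) 1)
  · exact congrArg Fin.val (liftEmb_last (pairEmb q a h))

/-- The pair `(q, cat)` in the real register. [folklore] -/
theorem pairEmb_trans_castSuccEmb (q a : Fin (K + 2)) (h : q ≠ a) :
    (pairEmb q a h).trans Fin.castSuccEmb = pairEmb (rl q) (rl a) (fun h' => h (rl_injective h')) := by
  ext j; fin_cases j <;> rfl

/-- `H` of the three-wire register placed on the third wire of a triple is `H` on that wire. [folklore] -/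
theorem placeGate_tripleEmb_hadamard_third {N : ℕ} (i j l : Fin N) (hij : i ≠ j) (hil : i ≠ l) (hjl : j ≠ l) :
    placeGate (tripleEmb i j l hij hil hjl) (placeGate (wireEmb (2 : Fin 3)) hGate) = placeGate (wireEmb l) hGate := by
  rw [placeGate_placeGate, wireEmb_trans]; rfl

/-! ### The three readings of a Clifford+`T` gate and its sign-basis word -/

/-- The placement of an `H` gate as a one-wire embedding (the arity of `H` is `1`). [folklore] -/
abbrev plH (e : Fin (cliffordT.arity CliffordTOp.H) ↪ Fin K) : Fin 1 ↪ Fin K := e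
/-- The placement of an `S` gate as a one-wire embedding. [folklore] -/
abbrev plS (e : Fin (cliffordT.arity CliffordTOp.S) ↪ Fin K) : Fin 1 ↪ Fin K := e
/-- The placement of a `T` gate as a one-wire embedding. [folklore] -/
abbrev plT (e : Fin (cliffordT.arity CliffordTOp.T) ↪ Fin K) : Fin 1 ↪ Fin K := e
/-- The placement of a `CNOT` gate as a two-wire embedding. [folklore] -/
abbrev plC (e : Fin (cliffordT.arity CliffordTOp.CNOT) ↪ Fin K) : Fin 2 ↪ Fin K := e

/-- **The gate, lifted** to the complex register (working wires first). [cite: NielsenChuang2010, §4.2] -/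
def tOp (g : QGate cliffordT K) : Matrix (QReg (K + 2)) (QReg (K + 2)) ℂ :=
  placeGate (Fin.castAddEmb 2) (g.toMatrix 0)

/-- **The gate with `T ↦ ZT`** (the action on the `|A⊥⟩`-branch). [cite: NielsenChuang2010, §10.6.2] -/
def ztOp : QGate cliffordT K → Matrix (QReg (K + 2)) (QReg (K + 2)) ℂ
  | .gate CliffordTOp.T e => placeGate (wireEmb (wk (plT e 0))) (pauliZ * tGate)
  | g => tOp g

/-- **The gate with `T ↦` the injection word through the catalyst.** [cite: NielsenChuang2010, §10.6.2 and Ex. 10.68] -/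
def injOp : QGate cliffordT K → Matrix (QReg (K + 2)) (QReg (K + 2)) ℂ
  | .gate CliffordTOp.T e => inject (wk (plT e 0)) (catC K) (wk_ne_catC _)
  | g => tOp g

/-- **The sign-basis word of a gate** on the real register: `H ↦ H`; `S ↦ CZ_{qρ} H_ρ CZ_{qρ} H_ρ`
(`reOp S = CNOT·CZ`); `CNOT ↦ H_t CZ_{ct} H_t`; `T ↦ H_a CZ_{qa} H_a · CCZ_{qaρ} H_ρ CCZ_{qaρ} H_ρ`
(CNOT onto the catalyst `a`, then the realified controlled-`S`); oracle gates (absent) to nothing.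
[cite: AaronsonAmbainis2018, §6 Lemma 24 (p. 26)] -/
def realGates : QGate cliffordT K → List (QGate hSign (K + 2 + 1))
  | .gate CliffordTOp.H e => [sH (rl (wk (plH e 0)))]
  | .gate CliffordTOp.S e =>
      [sCZ (rl (wk (plS e 0))) (rho K) (rl_ne_rho _), sH (rho K), sCZ (rl (wk (plS e 0))) (rho K) (rl_ne_rho _), sH (rho K)]
  | .gate CliffordTOp.T e =>
      [sH (rl (catC K)), sCZ (rl (wk (plT e 0))) (rl (catC K)) (fun h => wk_ne_catC _ (rl_injective h)), sH (rl (catC K)),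
       sCCZ (rl (wk (plT e 0))) (rl (catC K)) (rho K) (fun h => wk_ne_catC _ (rl_injective h)) (rl_ne_rho _) (rl_ne_rho _),
       sH (rho K),
       sCCZ (rl (wk (plT e 0))) (rl (catC K)) (rho K) (fun h => wk_ne_catC _ (rl_injective h)) (rl_ne_rho _) (rl_ne_rho _),
       sH (rho K)]
  | .gate CliffordTOp.CNOT e =>
      [sH (rl (wk (plC e 1))),
       sCZ (rl (wk (plC e 0))) (rl (wk (plC e 1))) (fun h => by
         have := (plC e).injective (Fin.castAdd_injective _ _ (rl_injective h)); simp at this),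
       sH (rl (wk (plC e 1)))]
  | .oracle _ _ => []

/-- Every gate of a sign-basis word is oracle-free. [folklore] -/
theorem realGates_isOracleFree (g : QGate cliffordT K) : ∀ g' ∈ realGates g, g'.IsOracleFree := by
  intro g' hg'
  rcases g with ⟨op, e⟩ | ⟨m, e⟩
  · rcases op with _ | _ | _ | _ <;>
      simp only [realGates, List.mem_cons, List.mem_nil_iff, or_false] at hg' <;>
      rcases hg' with rfl | rfl | rfl | rfl | rfl | rfl | rfl <;> exact trivial
  · simp [realGates] at hg'

/-! ### Matrices of the sign-basis words -/

/-- Matrix of a placed `H`. [folklore] -/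
theorem toMatrix_sH {N : ℕ} (i : Fin N) : (sH i).toMatrix 0 = placeGate (wireEmb i) hGate := rfl
/-- Matrix of a placed `CZ`. [folklore] -/
theorem toMatrix_sCZ {N : ℕ} (i j : Fin N) (h : i ≠ j) : (sCZ i j h).toMatrix 0 = placeGate (pairEmb i j h) cz := rfl
/-- Matrix of a placed `CCZ`. [folklore] -/
theorem toMatrix_sCCZ {N : ℕ} (i j l : Fin N) (hij : i ≠ j) (hil : i ≠ l) (hjl : j ≠ l) :
    (sCCZ i j l hij hil hjl).toMatrix 0 = placeGate (tripleEmb i j l hij hil hjl) ccsign := rfl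

/-- The `S`-word `CZ H CZ H` on `(q, ρ)` computes the placement of `CNOT · CZ`. [cite: BernsteinVazirani1997, §8] -/
theorem toMatrix_sWord {N : ℕ} (q r : Fin N) (h : q ≠ r) :
    (⟨[sCZ q r h, sH r, sCZ q r h, sH r]⟩ : QCircuit hSign N).toMatrix 0 = placeGate (pairEmb q r h) (cnot * cz) := by
  simp only [QCircuit.toMatrix, List.map_cons, List.map_nil, List.reverse_cons, List.reverse_nil, List.nil_append,
    List.cons_append, List.prod_cons, List.prod_nil, mul_one, toMatrix_sH, toMatrix_sCZ,
    placeGate_wireEmb_eq_pair_onSecond q r h]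
  have pm : ∀ U V : Matrix (QReg 2) (QReg 2) ℂ,
      placeGate (pairEmb q r h) U * placeGate (pairEmb q r h) V = placeGate (pairEmb q r h) (U * V) :=
    fun U V => (placeGate_mul_holds (pairEmb q r h) U V).symm
  simp only [pm]
  rw [cnot_eq_hadamard_cz_hadamard]
  simp only [mul_assoc]

/-- The `CNOT`-word `H CZ H` on `(c, t)` computes the placement of `CNOT`. [cite: NielsenChuang2010, §4.3] -/
theorem toMatrix_cnotWord {N : ℕ} (c t : Fin N) (h : c ≠ t) :
    (⟨[sH t, sCZ c t h, sH t]⟩ : QCircuit hSign N).toMatrix 0 = placeGate (pairEmb c t h) cnot := by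
  simp only [QCircuit.toMatrix, List.map_cons, List.map_nil, List.reverse_cons, List.reverse_nil, List.nil_append,
    List.cons_append, List.prod_cons, List.prod_nil, mul_one, toMatrix_sH, toMatrix_sCZ,
    placeGate_wireEmb_eq_pair_onSecond c t h]
  have pm : ∀ U V : Matrix (QReg 2) (QReg 2) ℂ,
      placeGate (pairEmb c t h) U * placeGate (pairEmb c t h) V = placeGate (pairEmb c t h) (U * V) :=
    fun U V => (placeGate_mul_holds (pairEmb c t h) U V).symm
  simp only [pm]
  rw [cnot_eq_hadamard_cz_hadamard]
  simp only [mul_assoc]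

/-- The realified controlled-`S` word `CCZ H_ρ CCZ H_ρ` on `(q, a, ρ)` computes the placement of
`reOp CS`. [cite: BernsteinVazirani1997, §8] -/
theorem toMatrix_csWord {N : ℕ} (q a r : Fin N) (hqa : q ≠ a) (hqr : q ≠ r) (har : a ≠ r) :
    (⟨[sCCZ q a r hqa hqr har, sH r, sCCZ q a r hqa hqr har, sH r]⟩ : QCircuit hSign N).toMatrix 0 =
      placeGate (tripleEmb q a r hqa hqr har) (reOp csGate) := by
  simp only [QCircuit.toMatrix, List.map_cons, List.map_nil, List.reverse_cons, List.reverse_nil, List.nil_append,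
    List.cons_append, List.prod_cons, List.prod_nil, mul_one, toMatrix_sH, toMatrix_sCCZ,
    ← placeGate_tripleEmb_hadamard_third q a r hqa hqr har]
  have pm : ∀ U V : Matrix (QReg 3) (QReg 3) ℂ, placeGate (tripleEmb q a r hqa hqr har) U * placeGate (tripleEmb q a r hqa hqr har) V =
      placeGate (tripleEmb q a r hqa hqr har) (U * V) := fun U V => (placeGate_mul_holds _ U V).symm
  simp only [pm]
  rw [reOp_csGate]
  simp only [mul_assoc]

/-- **The sign-basis word of a gate computes the realification of its injection reading.**
[cite: AaronsonAmbainis2018, §6 Lemma 24 (p. 26)] [cite: BernsteinVazirani1997, §8] -/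
theorem toMatrix_realGates (g : QGate cliffordT K) (hg : g.IsOracleFree) :
    (⟨realGates g⟩ : QCircuit hSign (K + 2 + 1)).toMatrix 0 = reOp (injOp g) := by
  rcases g with ⟨op, e⟩ | ⟨m, e⟩
  · rcases op with _ | _ | _ | _
    · -- H
      change (⟨[sH (rl (wk (plH e 0)))]⟩ : QCircuit hSign (K + 2 + 1)).toMatrix 0 =
        reOp (placeGate (Fin.castAddEmb 2) (placeGate (plH e) hGate))
      rw [placeGate_placeGate, reOp_placeGate_of_isRealMatrix _ isRealMatrix_hGate, trans_trans_fin_one]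
      simp [QCircuit.toMatrix, toMatrix_sH]
    · -- S
      change (⟨[sCZ (rl (wk (plS e 0))) (rho K) (rl_ne_rho _), sH (rho K), sCZ (rl (wk (plS e 0))) (rho K) (rl_ne_rho _),
          sH (rho K)]⟩ : QCircuit hSign (K + 2 + 1)).toMatrix 0 = reOp (placeGate (Fin.castAddEmb 2) (placeGate (plS e) sGate))
      rw [placeGate_placeGate, reOp_placeGate, reOp_sGate, liftEmb_fin_one, toMatrix_sWord]
      rfl
    · -- T
      have e1 : (⟨realGates (QGate.gate CliffordTOp.T e)⟩ : QCircuit hSign (K + 2 + 1)) =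
          (⟨[sH (rl (catC K)), sCZ (rl (wk (plT e 0))) (rl (catC K)) (fun h => wk_ne_catC _ (rl_injective h)), sH (rl (catC K))]⟩ :
            QCircuit hSign (K + 2 + 1)).append
          ⟨[sCCZ (rl (wk (plT e 0))) (rl (catC K)) (rho K) (fun h => wk_ne_catC _ (rl_injective h)) (rl_ne_rho _) (rl_ne_rho _),
            sH (rho K),
            sCCZ (rl (wk (plT e 0))) (rl (catC K)) (rho K) (fun h => wk_ne_catC _ (rl_injective h)) (rl_ne_rho _) (rl_ne_rho _),
            sH (rho K)]⟩ := rfl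
      change (⟨realGates (QGate.gate CliffordTOp.T e)⟩ : QCircuit hSign (K + 2 + 1)).toMatrix 0 =
        reOp (inject (wk (plT e 0)) (catC K) (wk_ne_catC _))
      rw [e1, QCircuit.toMatrix_append, toMatrix_csWord, toMatrix_cnotWord, inject_eq, reOp_mul, reOp_placeGate,
        liftEmb_pairEmb, cnotOn_toMatrix, reOp_placeGate_of_isRealMatrix _ isRealMatrix_cnot, pairEmb_trans_castSuccEmb]
    · -- CNOT
      change (⟨[sH (rl (wk (plC e 1))), sCZ (rl (wk (plC e 0))) (rl (wk (plC e 1))) _, sH (rl (wk (plC e 1)))]⟩ :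
          QCircuit hSign (K + 2 + 1)).toMatrix 0 = reOp (placeGate (Fin.castAddEmb 2) (placeGate (plC e) cnot))
      rw [placeGate_placeGate, reOp_placeGate_of_isRealMatrix _ isRealMatrix_cnot, trans_trans_fin_two, toMatrix_cnotWord]
  · exact absurd hg id

/-! ### Catalysis, gate by gate -/

/-- The injection reading pushes through `Π_A` as the gate itself: `injOp g · Π_A = Π_A · tOp g`.
[cite: NielsenChuang2010, §10.6.2 and Ex. 10.68] -/
theorem injOp_mul_projA (g : QGate cliffordT K) (hg : g.IsOracleFree) :
    injOp g * projAAt (catC K) = projAAt (catC K) * tOp g := by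
  rcases g with ⟨op, e⟩ | ⟨m, e⟩
  · rcases op with _ | _ | _ | _
    · exact placeGate_comm_wire (catC_not_mem_range_castAddEmb K) _ _
    · exact placeGate_comm_wire (catC_not_mem_range_castAddEmb K) _ _
    · change inject (wk (plT e 0)) (catC K) (wk_ne_catC _) * projAAt (catC K) =
        projAAt (catC K) * placeGate (Fin.castAddEmb 2) (placeGate (plT e) tGate)
      rw [inject_mul_projAAt_eq_projAAt_mul, placeGate_placeGate, trans_fin_one]
    · exact placeGate_comm_wire (catC_not_mem_range_castAddEmb K) _ _
  · exact absurd hg id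

/-- On the other branch: `injOp g · Π_⊥ = Π_⊥ · ztOp g`. [cite: NielsenChuang2010, §10.6.2 and Ex. 10.68] -/
theorem injOp_mul_projAperp (g : QGate cliffordT K) (hg : g.IsOracleFree) :
    injOp g * projAperpAt (catC K) = projAperpAt (catC K) * ztOp g := by
  rcases g with ⟨op, e⟩ | ⟨m, e⟩
  · rcases op with _ | _ | _ | _
    · exact placeGate_comm_wire (catC_not_mem_range_castAddEmb K) _ _
    · exact placeGate_comm_wire (catC_not_mem_range_castAddEmb K) _ _
    · change inject (wk (plT e 0)) (catC K) (wk_ne_catC _) * projAperpAt (catC K) =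
        projAperpAt (catC K) * placeGate (wireEmb (wk (plT e 0))) (pauliZ * tGate)
      exact inject_mul_projAperpAt_eq_projAperpAt_mul (wk (plT e 0)) (catC K) (wk_ne_catC _)
    · exact placeGate_comm_wire (catC_not_mem_range_castAddEmb K) _ _
  · exact absurd hg id

/-! ### Gate lists -/

/-- **The transcription of a Clifford+`T` gate list** to the sign basis. [cite: AaronsonAmbainis2018, §6 Lemma 24 (p. 26)] -/
def transcribe (gs : List (QGate cliffordT K)) : List (QGate hSign (K + 2 + 1)) :=
  gs.flatMap realGates

/-- The injection reading of a gate list (first gate rightmost, as `QCircuit.toMatrix`). [folklore] -/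
def injProd (gs : List (QGate cliffordT K)) : Matrix (QReg (K + 2)) (QReg (K + 2)) ℂ :=
  ((gs.map injOp).reverse).prod

/-- The plain reading of a gate list. [folklore] -/
def tProd (gs : List (QGate cliffordT K)) : Matrix (QReg (K + 2)) (QReg (K + 2)) ℂ :=
  ((gs.map tOp).reverse).prod

/-- The `ZT` reading of a gate list. [folklore] -/
def ztProd (gs : List (QGate cliffordT K)) : Matrix (QReg (K + 2)) (QReg (K + 2)) ℂ :=
  ((gs.map ztOp).reverse).prod

/-- The transcription is oracle-free. [folklore] -/
theorem transcribe_isOracleFree (gs : List (QGate cliffordT K)) : ∀ g' ∈ transcribe gs, g'.IsOracleFree := by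
  intro g' hg'
  obtain ⟨g, -, hg'⟩ := List.mem_flatMap.1 hg'
  exact realGates_isOracleFree g g' hg'

/-- `injProd` of a cons. [folklore] -/
theorem injProd_cons (g : QGate cliffordT K) (gs : List (QGate cliffordT K)) : injProd (g :: gs) = injProd gs * injOp g := by
  simp [injProd, List.prod_append]

/-- `tProd` of a cons. [folklore] -/
theorem tProd_cons (g : QGate cliffordT K) (gs : List (QGate cliffordT K)) : tProd (g :: gs) = tProd gs * tOp g := by
  simp [tProd, List.prod_append]

/-- `ztProd` of a cons. [folklore] -/
theorem ztProd_cons (g : QGate cliffordT K) (gs : List (QGate cliffordT K)) : ztProd (g :: gs) = ztProd gs * ztOp g := by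
  simp [ztProd, List.prod_append]

/-- **The transcription computes the realification of the injection reading.**
[cite: AaronsonAmbainis2018, §6 Lemma 24 (p. 26)] -/
theorem toMatrix_transcribe (gs : List (QGate cliffordT K)) (hgs : ∀ g ∈ gs, g.IsOracleFree) :
    (⟨transcribe gs⟩ : QCircuit hSign (K + 2 + 1)).toMatrix 0 = reOp (injProd gs) := by
  induction gs with
  | nil => simp [transcribe, injProd, reOp_one]
  | cons g gs ih =>
    have e1 : (⟨transcribe (g :: gs)⟩ : QCircuit hSign (K + 2 + 1)) =
        (⟨realGates g⟩ : QCircuit hSign (K + 2 + 1)).append ⟨transcribe gs⟩ := rfl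
    rw [e1, QCircuit.toMatrix_append, ih (fun g' hg' => hgs g' (by simp [hg'])), toMatrix_realGates g (hgs g (by simp)),
      injProd_cons, reOp_mul]

/-- **The plain reading is the circuit, lifted**: `tProd gs = (⟦gs⟧ on the working wires) ⊗ 1`. [folklore] -/
theorem tProd_eq (gs : List (QGate cliffordT K)) :
    tProd gs = placeGate (Fin.castAddEmb 2) ((⟨gs⟩ : QCircuit cliffordT K).toMatrix 0) := by
  induction gs with
  | nil => simp [tProd, placeGate_one]
  | cons g gs ih => rw [tProd_cons, ih, QCircuit.toMatrix_cons, placeGate_mul_holds]; rfl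

/-- **Catalysis for a gate list**: `injProd gs · Π_A = Π_A · tProd gs`. [cite: NielsenChuang2010, §10.6.2] -/
theorem injProd_mul_projA (gs : List (QGate cliffordT K)) (hgs : ∀ g ∈ gs, g.IsOracleFree) :
    injProd gs * projAAt (catC K) = projAAt (catC K) * tProd gs := by
  induction gs with
  | nil => simp [injProd, tProd]
  | cons g gs ih =>
    rw [injProd_cons, tProd_cons, mul_assoc, injOp_mul_projA g (hgs g (by simp)), ← mul_assoc,
      ih (fun g' hg' => hgs g' (by simp [hg'])), mul_assoc]

/-- Catalysis for a gate list, the other branch: `injProd gs · Π_⊥ = Π_⊥ · ztProd gs`. [cite: NielsenChuang2010, §10.6.2] -/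
theorem injProd_mul_projAperp (gs : List (QGate cliffordT K)) (hgs : ∀ g ∈ gs, g.IsOracleFree) :
    injProd gs * projAperpAt (catC K) = projAperpAt (catC K) * ztProd gs := by
  induction gs with
  | nil => simp [injProd, ztProd]
  | cons g gs ih =>
    rw [injProd_cons, ztProd_cons, mul_assoc, injOp_mul_projAperp g (hgs g (by simp)), ← mul_assoc,
      ih (fun g' hg' => hgs g' (by simp [hg'])), mul_assoc]

/-- Every `ztOp` is unitary. [cite: NielsenChuang2010, §4.2] -/
theorem ztOp_mem_unitaryGroup (g : QGate cliffordT K) : ztOp g ∈ Matrix.unitaryGroup (QReg (K + 2)) ℂ := by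
  have hU : ∀ g : QGate cliffordT K, tOp g ∈ Matrix.unitaryGroup (QReg (K + 2)) ℂ := fun g =>
    placeGate_mem_unitaryGroup_holds _ (QGate.toMatrix_mem_unitaryGroup_holds cliffordT_isUnitary_holds 0 g)
  rcases g with ⟨op, e⟩ | ⟨m, e⟩
  · rcases op with _ | _ | _ | _
    · exact hU _
    · exact hU _
    · exact placeGate_mem_unitaryGroup_holds _ (Submonoid.mul_mem _ pauliZ_mem_unitaryGroup_holds tGate_mem_unitaryGroup_holds)
    · exact hU _
  · exact hU _

/-- `ztProd gs` is unitary. [cite: NielsenChuang2010, §4.2] -/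
theorem ztProd_mem_unitaryGroup (gs : List (QGate cliffordT K)) : ztProd gs ∈ Matrix.unitaryGroup (QReg (K + 2)) ℂ := by
  unfold ztProd
  refine list_prod_mem fun M hM => ?_
  obtain ⟨g, -, rfl⟩ := List.mem_map.1 (List.mem_reverse.1 hM)
  exact ztOp_mem_unitaryGroup g

/-- `ztProd` acts on the working register only: it is `1 ⊗ ·`-free of the catalyst and helper, namely a
placement along the working wires. [folklore] -/
theorem ztProd_eq (gs : List (QGate cliffordT K)) :
    ∃ M : Matrix (QReg K) (QReg K) ℂ, M ∈ Matrix.unitaryGroup (QReg K) ℂ ∧ ztProd gs = placeGate (Fin.castAddEmb 2) M := by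
  induction gs with
  | nil => exact ⟨1, Submonoid.one_mem _, by simp [ztProd, placeGate_one]⟩
  | cons g gs ih =>
    obtain ⟨M, hM, hgs⟩ := ih
    have hg : ∃ U : Matrix (QReg K) (QReg K) ℂ, U ∈ Matrix.unitaryGroup (QReg K) ℂ ∧ ztOp g = placeGate (Fin.castAddEmb 2) U := by
      rcases g with ⟨op, e⟩ | ⟨m, e⟩
      · rcases op with _ | _ | _ | _
        · exact ⟨_, QGate.toMatrix_mem_unitaryGroup_holds cliffordT_isUnitary_holds 0 _, rfl⟩
        · exact ⟨_, QGate.toMatrix_mem_unitaryGroup_holds cliffordT_isUnitary_holds 0 _, rfl⟩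
        · refine ⟨placeGate (plT e) (pauliZ * tGate), placeGate_mem_unitaryGroup_holds _
            (Submonoid.mul_mem _ pauliZ_mem_unitaryGroup_holds tGate_mem_unitaryGroup_holds), ?_⟩
          change placeGate (wireEmb (wk (plT e 0))) (pauliZ * tGate) = _
          rw [placeGate_placeGate, trans_fin_one]
        · exact ⟨_, QGate.toMatrix_mem_unitaryGroup_holds cliffordT_isUnitary_holds 0 _, rfl⟩
      · exact ⟨_, QGate.toMatrix_mem_unitaryGroup_holds cliffordT_isUnitary_holds 0 _, rfl⟩
    obtain ⟨U, hU, hgU⟩ := hg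
    exact ⟨M * U, Submonoid.mul_mem _ hM hU, by rw [ztProd_cons, hgs, hgU, placeGate_mul_holds]⟩

/-! ### Wires of the transcription -/

/-- **Wires of a sign-basis word**: `ρ`, the catalyst, or a (real index of a) wire of the gate.
[folklore] -/
theorem mem_wires_realGates {g : QGate cliffordT K} {g' : QGate hSign (K + 2 + 1)} (hg' : g' ∈ realGates g)
    {w : Fin (K + 2 + 1)} (hw : w ∈ g'.wires) : w = rho K ∨ w = rl (catC K) ∨ ∃ i ∈ g.wires, w = rl (wk i) := by
  rcases g with ⟨op, e⟩ | ⟨m, e⟩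
  · have memw : ∀ (E : Fin (cliffordT.arity op) ↪ Fin K) (x : Fin (cliffordT.arity op)),
        E x ∈ (QGate.gate op E : QGate cliffordT K).wires :=
      fun E x => Finset.mem_map.2 ⟨x, Finset.mem_univ _, rfl⟩
    rcases op with _ | _ | _ | _ <;>
      simp only [realGates, List.mem_cons, List.mem_nil_iff, or_false] at hg' <;>
      rcases hg' with rfl | rfl | rfl | rfl | rfl | rfl | rfl <;>
      simp only [sH, sCZ, sCCZ, QGate.wires, Finset.mem_map, Finset.mem_univ, true_and] at hw <;>
      obtain ⟨j, rfl⟩ := hw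
    all_goals first
      | exact Or.inl rfl
      | exact Or.inr (Or.inl rfl)
      | exact Or.inr (Or.inr ⟨_, memw _ _, rfl⟩)
      | (fin_cases j <;> first
          | exact Or.inl rfl
          | exact Or.inr (Or.inl rfl)
          | exact Or.inr (Or.inr ⟨_, memw _ _, rfl⟩))
  · simp [realGates] at hg'

/-- **Wires of the transcription.** [folklore] -/
theorem mem_wires_transcribe {gs : List (QGate cliffordT K)} {g' : QGate hSign (K + 2 + 1)} (hg' : g' ∈ transcribe gs)
    {w : Fin (K + 2 + 1)} (hw : w ∈ g'.wires) : w = rho K ∨ w = rl (catC K) ∨ ∃ g ∈ gs, ∃ i ∈ g.wires, w = rl (wk i) := by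
  obtain ⟨g, hg, hg'⟩ := List.mem_flatMap.1 hg'
  rcases mem_wires_realGates hg' hw with h | h | ⟨i, hi, h⟩
  · exact Or.inl h
  · exact Or.inr (Or.inl h)
  · exact Or.inr (Or.inr ⟨g, hg, i, hi, h⟩)

/-- Length of a sign-basis word: at most `7` gates. [folklore] -/
theorem length_realGates_le (g : QGate cliffordT K) : (realGates g).length ≤ 7 := by
  rcases g with ⟨op, e⟩ | ⟨m, e⟩
  · rcases op with _ | _ | _ | _ <;> simp [realGates]
  · simp [realGates]

/-- Length of the transcription: at most `7` gates per gate. [folklore] -/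
theorem length_transcribe_le (gs : List (QGate cliffordT K)) : (transcribe gs).length ≤ 7 * gs.length := by
  induction gs with
  | nil => simp [transcribe]
  | cons g gs ih =>
    have : (transcribe (g :: gs)).length = (realGates g).length + (transcribe gs).length := by
      simp [transcribe, List.flatMap_cons]
    rw [this, List.length_cons]
    have := length_realGates_le g
    omega

end Lemma24

end Literature.Computability.QuantumComplexity

end
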